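import Mathlib
import Summits.Parity.BatemanHorn.Theses.IsogenyRedei

/-!
# Sketch (crux-strategist gen 4, `planner-cstrat-stmt-Parity-0870-s1-0`) — typed companions of
# STRATEGY-CENSUS.md gen 4 for crux stmt-Parity-0870 `PolyMobiusTail`

Nothing here is registered as a line and nothing touches the lead's skeleton
(`Cruxes/PolyMobiusTail/Lines/eta_free_multilinear_window.lean`, v4).  Contents:

* §D19 — the one typed split this pass could produce that is NOT a class/range cut of the CRUX: a split of the
  lead's open window stub `stub_window_linear_three_le` (k ≥ 3, linear) by the size of the smallest divisor,
  `WindowThreeCorner` (some `dᵢ ≤ x^σ`, every `σ`) and `WindowThreeInterior` (all `dᵢ > x^σ`, some `σ`), with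
  the composition `windowThree_of_corner_of_interior` PROVED.  It decomposes a STUB, not the crux: the crux's
  residue `stub_large` is untouched (census §Decomposition D19, verdict).
* §S12 — the engine statement behind the interior piece, typed as a strengthening S⁺ of that stub:
  `TrilinearKloostermanFractionSaving` (a power saving for the balanced cyclic product of Kloosterman
  fractions `e(ℓ(h₂·\overline{d₁d₃}/d₂ + h₃·\overline{d₁d₂}/d₃))` with Möbius coefficients).  Not proved, not
  claimed; it is the census's "S⁺ as a signature".
-/

open scoped BigOperators
open Filter Finset Asymptotics Classical

namespace Summit.Parity.BatemanHorn.Cruxes.PolyMobiusTail.StrategistS1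

open Literature.NumberTheory.Sieve Polynomial

/-- The window summand weight `∏ μ(dᵢ) log dᵢ`. -/
noncomputable def weight {k : ℕ} (d : Fin k → ℕ) : ℝ :=
  ∏ i, ((ArithmeticFunction.moebius (d i) : ℝ) * Real.log (d i))

/-- The k ≥ 3 linear window statement — verbatim the lead's `stub_window_linear_three_le`. -/
def WindowThree : Prop :=
  ∀ (k : ℕ) (f : Fin k → ℤ[X]), IsBatemanHornSystem f → 3 ≤ k → (∀ i, (f i).natDegree ≤ 1) →
    ∃ θ : ℝ, 0 < θ ∧ θ < 1 ∧ ∃ η : ℝ, 0 < η ∧ η < 1 ∧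
      (fun x : ℕ => ∑ n ∈ Finset.Icc 1 x,
        ∑ d ∈ Fintype.piFinset (fun i => (((f i).eval (n : ℤ)).toNat).divisors),
          if (x : ℝ) ^ (1 - η) < ∏ i, (d i : ℝ) ∧ ∏ i, (d i : ℝ) ≤ (x : ℝ) ^ (1 + θ) then
            ∏ i, ((ArithmeticFunction.moebius (d i) : ℝ) * Real.log (d i)) else 0)
        =o[atTop] fun x : ℕ => (x : ℝ)

/-- **D19 piece 1 (corner).** For every `σ ∈ (0, 1/3)`: the part of the window with SOME `dᵢ ≤ x^σ` is `o(x)`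
for all small `θ, η` (shape of the landed `stub_pair_corner`: `∀ σ ∃ c ∀ θ η ≤ c`).  Expected theorem-grade by
recursion to the `(k-1)`-window along the progression `n ≡ -hᵢ (mod dᵢ)` with uniformity in the modulus
`dᵢ ≤ x^σ` (BV corner / dispersion / DFI with one extra trivially-summed small modulus). -/
def WindowThreeCorner : Prop :=
  ∀ (k : ℕ) (f : Fin k → ℤ[X]), IsBatemanHornSystem f → 3 ≤ k → (∀ i, (f i).natDegree ≤ 1) →
    ∀ σ : ℝ, 0 < σ → σ < 1 / 3 → ∃ c : ℝ, 0 < c ∧ ∀ θ η : ℝ, 0 < θ → θ ≤ c → 0 < η → η ≤ c →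
      (fun x : ℕ => ∑ n ∈ Finset.Icc 1 x,
        ∑ d ∈ Fintype.piFinset (fun i => (((f i).eval (n : ℤ)).toNat).divisors),
          if ((x : ℝ) ^ (1 - η) < ∏ i, (d i : ℝ) ∧ ∏ i, (d i : ℝ) ≤ (x : ℝ) ^ (1 + θ)) ∧
              (∃ i, (d i : ℝ) ≤ (x : ℝ) ^ σ) then weight d else 0)
        =o[atTop] fun x : ℕ => (x : ℝ)

/-- **D19 piece 2 (interior = the multilinear core).** For SOME `σ ∈ (0, 1/3)`: the part of the window with
ALL `dᵢ > x^σ` is `o(x)` for all small `θ, η`.  This is where the balanced cyclic product of Kloosterman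
fractions lives (S12 below); open. -/
def WindowThreeInterior : Prop :=
  ∀ (k : ℕ) (f : Fin k → ℤ[X]), IsBatemanHornSystem f → 3 ≤ k → (∀ i, (f i).natDegree ≤ 1) →
    ∃ σ : ℝ, 0 < σ ∧ σ < 1 / 3 ∧ ∃ c : ℝ, 0 < c ∧ ∀ θ η : ℝ, 0 < θ → θ ≤ c → 0 < η → η ≤ c →
      (fun x : ℕ => ∑ n ∈ Finset.Icc 1 x,
        ∑ d ∈ Fintype.piFinset (fun i => (((f i).eval (n : ℤ)).toNat).divisors),
          if ((x : ℝ) ^ (1 - η) < ∏ i, (d i : ℝ) ∧ ∏ i, (d i : ℝ) ≤ (x : ℝ) ^ (1 + θ)) ∧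
              (∀ i, (x : ℝ) ^ σ < (d i : ℝ)) then weight d else 0)
        =o[atTop] fun x : ℕ => (x : ℝ)

/-- Pointwise split of the window summand by the corner / interior predicate. -/
theorem summand_split (W : Prop) [Decidable W] {k : ℕ} (d : Fin k → ℕ) (x : ℕ) (σ : ℝ) (w : ℝ) :
    (if W then w else 0)
      = (if W ∧ (∃ i, (d i : ℝ) ≤ (x : ℝ) ^ σ) then w else 0)
        + (if W ∧ (∀ i, (x : ℝ) ^ σ < (d i : ℝ)) then w else 0) := by
  by_cases hW : W
  · by_cases hc : ∃ i, (d i : ℝ) ≤ (x : ℝ) ^ σ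
    · have hni : ¬ ∀ i, (x : ℝ) ^ σ < (d i : ℝ) := by
        push Not
        exact hc
      simp [hW, hc, hni]
    · have hi : ∀ i, (x : ℝ) ^ σ < (d i : ℝ) := by
        push Not at hc
        exact hc
      simp [hW, hc, hi]
  · simp [hW]

/-- **D19 composition (PROVED).** Corner ∧ Interior ⇒ the k ≥ 3 linear window stub. -/
theorem windowThree_of_corner_of_interior (hC : WindowThreeCorner) (hI : WindowThreeInterior) :
    WindowThree := by
  intro k f hf hk hlin
  obtain ⟨σ, hσ0, hσ1, c₁, hc₁, hI'⟩ := hI k f hf hk hlin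
  obtain ⟨c₂, hc₂, hC'⟩ := hC k f hf hk hlin σ hσ0 hσ1
  set c : ℝ := min (min c₁ c₂) (1 / 2) with hc
  have hc0 : 0 < c := lt_min (lt_min hc₁ hc₂) (by norm_num)
  have hcle1 : c ≤ c₁ := (min_le_left _ _).trans (min_le_left _ _)
  have hcle2 : c ≤ c₂ := (min_le_left _ _).trans (min_le_right _ _)
  have hclt : c < 1 := (min_le_right _ _).trans_lt (by norm_num)
  refine ⟨c, hc0, hclt, c, hc0, hclt, ?_⟩
  have h1 := hC' c c hc0 hcle2 hc0 hcle2
  have h2 := hI' c c hc0 hcle1 hc0 hcle1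
  refine (h1.add h2).congr_left fun x => ?_
  try dsimp only
  rw [← Finset.sum_add_distrib]
  refine Finset.sum_congr rfl fun n _ => ?_
  rw [← Finset.sum_add_distrib]
  refine Finset.sum_congr rfl fun d _ => ?_
  unfold weight
  by_cases hW : ((x : ℝ) ^ (1 - c) < ∏ i, (d i : ℝ) ∧ ∏ i, (d i : ℝ) ≤ (x : ℝ) ^ (1 + c))
  · by_cases hcor : ∃ i, (d i : ℝ) ≤ (x : ℝ) ^ σ
    · have hni : ¬ ∀ i, (x : ℝ) ^ σ < (d i : ℝ) := by
        push Not
        exact hcor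
      simp [hW, hcor, hni]
    · have hi : ∀ i, (x : ℝ) ^ σ < (d i : ℝ) := by
        push Not at hcor
        exact hcor
      simp [hW, hcor, hi]
  · simp [hW]

/-! ## S12 — the engine behind `WindowThreeInterior`, as a signature (not claimed)

Balanced cyclic product of Kloosterman fractions for the 3-tuple `(X, X+h₂, X+h₃)` (shift `h₁ = 0`;
BarrierNotesIdeator4 B20): with `D = d₁d₂d₃` pairwise coprime the Poisson-dual phase of the window count is
`e(ℓ·c_D/D)`, `c_D/D ≡ -(h₂·\overline{d₁d₃}/d₂ + h₃·\overline{d₁d₂}/d₃) (mod 1)`.  A power saving `(N₁N₂N₃)^{1-δ}`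
uniformly for boxes with every `Nᵢ ≥ (N₁N₂N₃)^{1/3-κ}` and frequencies `0 < |ℓ| ≤ (N₁N₂N₃)^{δ}` would close the
interior piece (census T12 / S12).  `invMod a m` below is the inverse of `a` modulo `m` as a natural number
(junk `0` when not invertible; the sum only uses coprime tuples). -/

/-- Inverse of `a` modulo `m`, as a natural number in `[0, m)` (`0` if not a unit). -/
noncomputable def invMod (a m : ℕ) : ℕ := ((a : ZMod m)⁻¹).val

/-- The balanced trilinear Kloosterman-fraction sum with Möbius coefficients. -/
noncomputable def trilinearKF (h₂ h₃ : ℤ) (ℓ : ℤ) (N₁ N₂ N₃ : ℕ) : ℂ :=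
  ∑ d₁ ∈ Finset.Ico N₁ (2 * N₁), ∑ d₂ ∈ Finset.Ico N₂ (2 * N₂), ∑ d₃ ∈ Finset.Ico N₃ (2 * N₃),
    if Nat.Coprime d₁ d₂ ∧ Nat.Coprime d₁ d₃ ∧ Nat.Coprime d₂ d₃ then
      (ArithmeticFunction.moebius d₁ : ℂ) * (ArithmeticFunction.moebius d₂ : ℂ) *
        (ArithmeticFunction.moebius d₃ : ℂ) *
        Complex.exp (2 * Real.pi * Complex.I *
          ((ℓ * (h₂ * (invMod (d₁ * d₃) d₂ : ℝ) / (d₂ : ℝ) + h₃ * (invMod (d₁ * d₂) d₃ : ℝ) / (d₃ : ℝ)) : ℝ) : ℂ))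
    else 0

/-- **S12 · `TrilinearKloostermanFractionSaving` (S⁺ of the interior piece; OPEN, not in print).** -/
def TrilinearKloostermanFractionSaving : Prop :=
  ∀ h₂ h₃ : ℤ, h₂ ≠ 0 → h₃ ≠ 0 → h₂ ≠ h₃ → ∀ κ : ℝ, 0 < κ → κ < 1 / 3 →
    ∃ δ : ℝ, 0 < δ ∧ ∃ C : ℝ, ∀ N₁ N₂ N₃ : ℕ, ∀ ℓ : ℤ, ℓ ≠ 0 →
      (|(ℓ : ℝ)| ≤ ((N₁ * N₂ * N₃ : ℕ) : ℝ) ^ δ) →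
      (∀ N ∈ ({N₁, N₂, N₃} : Finset ℕ), ((N₁ * N₂ * N₃ : ℕ) : ℝ) ^ (1 / 3 - κ) ≤ (N : ℝ)) →
        ‖trilinearKF h₂ h₃ ℓ N₁ N₂ N₃‖ ≤ C * ((N₁ * N₂ * N₃ : ℕ) : ℝ) ^ (1 - δ)

end Summit.Parity.BatemanHorn.Cruxes.PolyMobiusTail.StrategistS1
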